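import Literature.Geometry.Symplectic.LegendrianStabilisationModel
import HarnessLib

/-!
# The model Legendrian stabilisation, II: the framing along the isotopy and the added twist

Topic `Literature/Geometry/Symplectic`; sequel of `LegendrianStabilisationModel.lean` (brick **M**
of the proof of `Literature.Geometry.Symplectic.Gompf1998_addLeftTwists`; Gompf 1998, §1).  For
the straight-line isotopy `curve τ` from the `x`-axis to the stabilised Legendrian arc `K₁` of
that file we construct, and **prove** everything about:

* `fr u = (0, pfr u, qfr u)` — a continuous unit framing field in the `(y, z)`-plane depending on
  the curve parameter only: `e_z` for `u ≤ -t₀` and `u ≥ t₀ + 1` (`fr_eq_ez` off `(-2, 2)`),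
  `∝ (-Y x', Y')` on `[-t₀, t₀]` (a clockwise half turn to `-e_z`) and the explicit
  counter-clockwise half turn `(sin π(u - t₀), -cos π(u - t₀))` back to `e_z` on `[t₀, t₀ + 1]`;
* `fr_ne_smul`, `fr_ne_smul_dscurve` — **`fr` is nowhere tangent to any stage** `K_τ`,
  `0 ≤ τ ≤ 1`, also after the anisotropic rescaling of brick M (tangency requires `x_τ' = 0`, i.e.
  `|u| ≤ t₀`, where the velocity `(0, τY', ετ Y x')` is never parallel to `(-Y x', Y')`);
* the model twisting loops `v0 = p + iq` (axis framed by `fr`) and `v1 = x' p + i q` (`K₁` framed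
  by `fr`) — for `α₀ = dz - y dx` one has `dα₀(K', fr) = x' p`, `α₀(fr) = q` — with continuous
  logarithms `l0` (principal branch: `p ≥ 0`) and `l1` (pieced from `log(-v₁) + iπ` on
  `[-t₀, t₀]`, where `Re v₁ ≤ 0`, and `log v₁ + 2πi` on `[t₀, t₀ + 1]`, where `Re v₁ ≥ 0`):
  `exp_l0`, `exp_l1`, and **`l0_two_sub : l0 2 - l0 (-2) = 0`**,
  **`l1_two_sub : l1 2 - l1 (-2) = 2πi`** — across the window the framed stabilised arc makes
  exactly one more positive turn relative to the contact framing than the framed axis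
  ("`tb` drops by one", Gompf 1998, §1);
* `frh s u` — the phase-0 homotopy of framings of the fixed axis from `e_z` (`frh_zero_left`) to
  `fr` (`frh_one_left`), constant `e_z` off `(-2, 2)` (`frh_of_two_le`), never vanishing and with
  no `x`-component (`frh_ne_smul`: never tangent to the axis).

No named facts are introduced.

## References

* R. E. Gompf, *Handlebody construction of Stein surfaces*, Ann. of Math. 148 (1998), §1.
  [Gompf1998]
-/

noncomputable section

open Real Set Filter MeasureTheory
open scoped Topology ContDiff

namespace Literature.Geometry.Symplectic.LegendrianModel

/-- `ℝ³`. -/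
local notation "E3" => EuclideanSpace ℝ (Fin 3)

/-! ### The framing field along the isotopy

The framing is a unit vector field `fr(u) = (0, p(u), q(u))` in the `(y, z)`-plane depending on
the curve parameter only: `e_z = (0, 0, 1)` for `u ≤ -t₀` and `u ≥ t₀ + 1`, perpendicular (in the
`(y, z)`-plane) to `(Y', Y x')` on `[-t₀, t₀]` — half a clockwise turn from `e_z` to `-e_z` — and
an explicit counter-clockwise half turn back on `[t₀, t₀ + 1]`.  It is nowhere tangent to any
stage `K_τ`: tangency can only occur where `x_τ' = 0`, i.e. for `|u| ≤ t₀`, where the velocity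
`(0, τ Y', τ Y x')` is perpendicular to the framing. -/

/-- The normaliser `N(u) = √((Y x')² + (Y')²)`, positive on `(-4, 4)`. [folklore] -/
def Nrm (u : ℝ) : ℝ := Real.sqrt ((Y u * xd u) ^ 2 + dY u ^ 2)

/-- `N ≥ 0`. [folklore] -/
theorem Nrm_nonneg (u : ℝ) : 0 ≤ Nrm u := Real.sqrt_nonneg _

/-- `(Y x')² + (Y')² > 0` on `(-4, 4)`: `Y x'` and `Y'` have no common zero there. [folklore] -/
theorem Y_mul_xd_sq_add_dY_sq_pos {u : ℝ} (hu : |u| < 4) : 0 < (Y u * xd u) ^ 2 + dY u ^ 2 := by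
  rcases eq_or_ne (xd u) 0 with h | h
  · have ht : |u| = t0 := xd_eq_zero_iff.1 h
    have hu0 : u ≠ 0 := fun h0 => by rw [h0, abs_zero] at ht; exact t0_pos.ne ht
    have := dY_ne_zero hu0 hu
    positivity
  · have := mul_ne_zero (Y_pos hu).ne' h
    positivity

/-- `N > 0` on `(-4, 4)`. [folklore] -/
theorem Nrm_pos {u : ℝ} (hu : |u| < 4) : 0 < Nrm u := Real.sqrt_pos.2 (Y_mul_xd_sq_add_dY_sq_pos hu)

/-- `N² = (Y x')² + (Y')²`. [folklore] -/
theorem Nrm_sq {u : ℝ} : Nrm u ^ 2 = (Y u * xd u) ^ 2 + dY u ^ 2 :=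
  Real.sq_sqrt (by positivity)

/-- `N` is continuous. [folklore] -/
theorem continuous_Nrm : Continuous Nrm :=
  Real.continuous_sqrt.comp (((continuous_Y.mul continuous_xd).pow 2).add (continuous_dY.pow 2))

/-- `|u| ≤ t₀` implies `|u| < 4`. [folklore] -/
theorem abs_lt_four_of_abs_le_t0 {u : ℝ} (hu : |u| ≤ t0) : |u| < 4 :=
  hu.trans_lt (t0_lt_one.trans (by norm_num))

/-- The clamp to `[-t₀, t₀]`. [folklore] -/
def clampMid (u : ℝ) : ℝ := max (-t0) (min u t0)

/-- The clamp to `[t₀, t₀ + 1]`. [folklore] -/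
def clampRet (u : ℝ) : ℝ := max t0 (min u (t0 + 1))

/-- The clamp is continuous. [folklore] -/
theorem continuous_clampMid : Continuous clampMid :=
  continuous_const.max (continuous_id.min continuous_const)

/-- The clamp is continuous. [folklore] -/
theorem continuous_clampRet : Continuous clampRet :=
  continuous_const.max (continuous_id.min continuous_const)

/-- The clamp takes values in `[-t₀, t₀]`. [folklore] -/
theorem abs_clampMid_le (u : ℝ) : |clampMid u| ≤ t0 := by
  unfold clampMid
  rw [abs_le]; constructor
  · exact le_max_left _ _
  · exact max_le (by linarith [t0_pos]) (min_le_right _ _)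

/-- The clamp is the identity on `[-t₀, t₀]`. [folklore] -/
theorem clampMid_of_mem {u : ℝ} (hu : u ∈ Icc (-t0) t0) : clampMid u = u := by
  unfold clampMid; rw [min_eq_left hu.2, max_eq_right hu.1]

/-- The clamp takes values in `[t₀, t₀ + 1]`. [folklore] -/
theorem clampRet_mem (u : ℝ) : clampRet u ∈ Icc t0 (t0 + 1) :=
  ⟨le_max_left _ _, max_le (by linarith) (min_le_right _ _)⟩

/-- The clamp is the identity on `[t₀, t₀ + 1]`. [folklore] -/
theorem clampRet_of_mem {u : ℝ} (hu : u ∈ Icc t0 (t0 + 1)) : clampRet u = u := by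
  unfold clampRet; rw [min_eq_left hu.2, max_eq_right hu.1]

/-- The middle branch of `p`: `-Y x' / N` (clamped argument). [folklore] -/
def pMid (u : ℝ) : ℝ := -(Y (clampMid u) * xd (clampMid u)) / Nrm (clampMid u)

/-- The middle branch of `q`: `Y' / N` (clamped argument). [folklore] -/
def qMid (u : ℝ) : ℝ := dY (clampMid u) / Nrm (clampMid u)

/-- The returning branch of `p`: `sin (π (u - t₀))`. [folklore] -/
def pRet (u : ℝ) : ℝ := Real.sin (π * (u - t0))

/-- The returning branch of `q`: `-cos (π (u - t₀))`. [folklore] -/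
def qRet (u : ℝ) : ℝ := -Real.cos (π * (u - t0))

/-- `pMid` is continuous (the normaliser is positive on the clamped range). [folklore] -/
theorem continuous_pMid : Continuous pMid := by
  refine ((continuous_Y.comp continuous_clampMid).mul (continuous_xd.comp continuous_clampMid)).neg.div
    (continuous_Nrm.comp continuous_clampMid) fun u => ?_
  exact (Nrm_pos (abs_lt_four_of_abs_le_t0 (abs_clampMid_le u))).ne'

/-- `qMid` is continuous. [folklore] -/
theorem continuous_qMid : Continuous qMid := by
  refine (continuous_dY.comp continuous_clampMid).div (continuous_Nrm.comp continuous_clampMid) fun u => ?_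
  exact (Nrm_pos (abs_lt_four_of_abs_le_t0 (abs_clampMid_le u))).ne'

/-- `pRet` is continuous. [folklore] -/
theorem continuous_pRet : Continuous pRet :=
  Real.continuous_sin.comp (continuous_const.mul (continuous_id.sub continuous_const))

/-- `qRet` is continuous. [folklore] -/
theorem continuous_qRet : Continuous qRet :=
  (Real.continuous_cos.comp (continuous_const.mul (continuous_id.sub continuous_const))).neg

/-- **The `y`-component `p` of the framing.** [folklore] -/
def pfr (u : ℝ) : ℝ :=
  if u ≤ -t0 then 0 else if u ≤ t0 then pMid u else if u ≤ t0 + 1 then pRet u else 0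

/-- **The `z`-component `q` of the framing.** [folklore] -/
def qfr (u : ℝ) : ℝ :=
  if u ≤ -t0 then 1 else if u ≤ t0 then qMid u else if u ≤ t0 + 1 then qRet u else 1

/-- `N(-t₀) = Y'(-t₀)` (there `x' = 0` and `Y' > 0`). [folklore] -/
theorem Nrm_neg_t0 : Nrm (-t0) = dY (-t0) := by
  have h : xd (-t0) = 0 := xd_eq_zero_of_abs_eq (by rw [abs_neg, abs_t0])
  rw [Nrm, h, mul_zero, sq (0:ℝ), zero_mul, zero_add, Real.sqrt_sq]
  exact (dY_pos_of_neg (by linarith [t0_pos]) (by linarith [t0_lt_one])).le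

/-- `N(t₀) = -Y'(t₀)` (there `x' = 0` and `Y' < 0`). [folklore] -/
theorem Nrm_t0 : Nrm t0 = -dY t0 := by
  rw [Nrm, xd_t0, mul_zero, sq (0:ℝ), zero_mul, zero_add, ← neg_sq, Real.sqrt_sq]
  linarith [dY_neg_of_pos t0_pos (t0_lt_one.trans (by norm_num))]

/-- `pMid (-t₀) = 0`. [folklore] -/
theorem pMid_neg_t0 : pMid (-t0) = 0 := by
  rw [pMid, clampMid_of_mem ⟨le_rfl, by linarith [t0_pos]⟩,
    xd_eq_zero_of_abs_eq (by rw [abs_neg, abs_t0])]; simp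

/-- `qMid (-t₀) = 1`. [folklore] -/
theorem qMid_neg_t0 : qMid (-t0) = 1 := by
  rw [qMid, clampMid_of_mem ⟨le_rfl, by linarith [t0_pos]⟩, Nrm_neg_t0]
  exact div_self (dY_pos_of_neg (by linarith [t0_pos]) (by linarith [t0_lt_one])).ne'

/-- `pMid t₀ = 0`. [folklore] -/
theorem pMid_t0 : pMid t0 = 0 := by
  rw [pMid, clampMid_of_mem ⟨by linarith [t0_pos], le_rfl⟩, xd_t0]; simp

/-- `qMid t₀ = -1`. [folklore] -/
theorem qMid_t0 : qMid t0 = -1 := by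
  rw [qMid, clampMid_of_mem ⟨by linarith [t0_pos], le_rfl⟩, Nrm_t0, div_neg, div_self]
  exact (dY_neg_of_pos t0_pos (t0_lt_one.trans (by norm_num))).ne

/-- `pRet t₀ = 0`. [folklore] -/
@[simp] theorem pRet_t0 : pRet t0 = 0 := by simp [pRet]
/-- `qRet t₀ = -1`. [folklore] -/
@[simp] theorem qRet_t0 : qRet t0 = -1 := by simp [qRet]

/-- `pRet (t₀ + 1) = 0`. [folklore] -/
theorem pRet_t0_add_one : pRet (t0 + 1) = 0 := by simp [pRet]

/-- `qRet (t₀ + 1) = 1`. [folklore] -/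
theorem qRet_t0_add_one : qRet (t0 + 1) = 1 := by simp [qRet]

/-- **`p` is continuous** (the branches match at `-t₀`, `t₀`, `t₀ + 1`). [folklore] -/
theorem continuous_pfr : Continuous pfr := by
  refine continuous_if_le continuous_id continuous_const continuousOn_const ?_ ?_
  · refine Continuous.continuousOn ?_
    refine continuous_if_le continuous_id continuous_const continuous_pMid.continuousOn ?_ ?_
    · exact (continuous_if_le continuous_id continuous_const continuous_pRet.continuousOn
        continuousOn_const (fun u hu => by rw [show u = t0 + 1 from hu, pRet_t0_add_one])).continuousOn
    · intro u hu; rw [hu, pMid_t0, if_pos (by linarith), pRet_t0]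
  · intro u hu
    rw [hu, if_pos (by linarith [t0_pos]), pMid_neg_t0]

/-- **`q` is continuous** (the branches match at `-t₀`, `t₀`, `t₀ + 1`). [folklore] -/
theorem continuous_qfr : Continuous qfr := by
  refine continuous_if_le continuous_id continuous_const continuousOn_const ?_ ?_
  · refine Continuous.continuousOn ?_
    refine continuous_if_le continuous_id continuous_const continuous_qMid.continuousOn ?_ ?_
    · exact (continuous_if_le continuous_id continuous_const continuous_qRet.continuousOn
        continuousOn_const (fun u hu => by rw [show u = t0 + 1 from hu, qRet_t0_add_one])).continuousOn
    · intro u hu; rw [hu, qMid_t0, if_pos (by linarith), qRet_t0]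
  · intro u hu
    rw [hu, if_pos (by linarith [t0_pos]), qMid_neg_t0]

/-! Branch descriptions. -/

/-- `p = 0` on `(-∞, -t₀]`. [folklore] -/
theorem pfr_of_le {u : ℝ} (hu : u ≤ -t0) : pfr u = 0 := by rw [pfr, if_pos hu]
/-- `q = 1` on `(-∞, -t₀]`. [folklore] -/
theorem qfr_of_le {u : ℝ} (hu : u ≤ -t0) : qfr u = 1 := by rw [qfr, if_pos hu]

/-- `p = -Y x' / N` on `[-t₀, t₀]`. [folklore] -/
theorem pfr_of_mem {u : ℝ} (hu : u ∈ Icc (-t0) t0) : pfr u = -(Y u * xd u) / Nrm u := by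
  rcases hu.1.eq_or_lt with h | h
  · rw [← h, pfr_of_le le_rfl, xd_eq_zero_of_abs_eq (by rw [abs_neg, abs_t0])]; simp
  · rw [pfr, if_neg (not_le.2 h), if_pos hu.2, pMid, clampMid_of_mem hu]

/-- `q = Y' / N` on `[-t₀, t₀]`. [folklore] -/
theorem qfr_of_mem {u : ℝ} (hu : u ∈ Icc (-t0) t0) : qfr u = dY u / Nrm u := by
  rcases hu.1.eq_or_lt with h | h
  · rw [← h, qfr_of_le le_rfl, Nrm_neg_t0, div_self]
    exact (dY_pos_of_neg (by linarith [t0_pos]) (by linarith [t0_lt_one])).ne'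
  · rw [qfr, if_neg (not_le.2 h), if_pos hu.2, qMid, clampMid_of_mem hu]

/-- `p = sin (π (u - t₀))` on `[t₀, t₀ + 1]`. [folklore] -/
theorem pfr_of_mem_ret {u : ℝ} (hu : u ∈ Icc t0 (t0 + 1)) : pfr u = Real.sin (π * (u - t0)) := by
  rcases hu.1.eq_or_lt with h | h
  · rw [← h, pfr_of_mem ⟨by linarith [t0_pos], le_rfl⟩, xd_t0]; simp
  · rw [pfr, if_neg (by linarith [t0_pos]), if_neg (not_le.2 h), if_pos hu.2, pRet]

/-- `q = -cos (π (u - t₀))` on `[t₀, t₀ + 1]`. [folklore] -/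
theorem qfr_of_mem_ret {u : ℝ} (hu : u ∈ Icc t0 (t0 + 1)) : qfr u = -Real.cos (π * (u - t0)) := by
  rcases hu.1.eq_or_lt with h | h
  · rw [← h, qfr_of_mem ⟨by linarith [t0_pos], le_rfl⟩, Nrm_t0, div_neg, div_self
      (dY_neg_of_pos t0_pos (t0_lt_one.trans (by norm_num))).ne]; simp
  · rw [qfr, if_neg (by linarith [t0_pos]), if_neg (not_le.2 h), if_pos hu.2, qRet]

/-- `p = 0` on `[t₀ + 1, ∞)`. [folklore] -/
theorem pfr_of_ge {u : ℝ} (hu : t0 + 1 ≤ u) : pfr u = 0 := by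
  rcases hu.eq_or_lt with h | h
  · rw [← h, pfr_of_mem_ret ⟨by linarith, le_rfl⟩]; simp
  · rw [pfr, if_neg (by linarith [t0_pos]), if_neg (by linarith), if_neg (not_le.2 h)]

/-- `q = 1` on `[t₀ + 1, ∞)`. [folklore] -/
theorem qfr_of_ge {u : ℝ} (hu : t0 + 1 ≤ u) : qfr u = 1 := by
  rcases hu.eq_or_lt with h | h
  · rw [← h, qfr_of_mem_ret ⟨by linarith, le_rfl⟩]; simp
  · rw [qfr, if_neg (by linarith [t0_pos]), if_neg (by linarith), if_neg (not_le.2 h)]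

/-- The framing is a unit vector. [folklore] -/
theorem pfr_sq_add_qfr_sq (u : ℝ) : pfr u ^ 2 + qfr u ^ 2 = 1 := by
  rcases le_or_gt u (-t0) with h1 | h1
  · rw [pfr_of_le h1, qfr_of_le h1]; norm_num
  rcases le_or_gt u t0 with h2 | h2
  · have hN := Nrm_pos (abs_lt_four_of_abs_le_t0 (abs_le.2 ⟨h1.le, h2⟩))
    rw [pfr_of_mem ⟨h1.le, h2⟩, qfr_of_mem ⟨h1.le, h2⟩, div_pow, div_pow, neg_sq, ← add_div,
      ← Nrm_sq, div_self (pow_ne_zero 2 hN.ne')]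
  rcases le_or_gt u (t0 + 1) with h3 | h3
  · rw [pfr_of_mem_ret ⟨h2.le, h3⟩, qfr_of_mem_ret ⟨h2.le, h3⟩, neg_sq, Real.sin_sq_add_cos_sq]
  · rw [pfr_of_ge h3.le, qfr_of_ge h3.le]; norm_num

/-- `p ≥ 0` everywhere. [folklore] -/
theorem pfr_nonneg (u : ℝ) : 0 ≤ pfr u := by
  rcases le_or_gt u (-t0) with h1 | h1
  · rw [pfr_of_le h1]
  rcases le_or_gt u t0 with h2 | h2
  · rw [pfr_of_mem ⟨h1.le, h2⟩, neg_div]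
    have hxd : xd u ≤ 0 := xd_nonpos_iff.2 (abs_le.2 ⟨h1.le, h2⟩)
    have : Y u * xd u / Nrm u ≤ 0 :=
      div_nonpos_of_nonpos_of_nonneg (mul_nonpos_of_nonneg_of_nonpos (Y_nonneg u) hxd) (Nrm_nonneg u)
    linarith
  rcases le_or_gt u (t0 + 1) with h3 | h3
  · rw [pfr_of_mem_ret ⟨h2.le, h3⟩]
    exact Real.sin_nonneg_of_nonneg_of_le_pi (by nlinarith [Real.pi_pos])
      (by nlinarith [Real.pi_pos])
  · rw [pfr_of_ge h3.le]

/-- Where `p = 0`, `q = ±1 ≠ 0`. [folklore] -/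
theorem qfr_ne_zero_of_pfr_eq_zero {u : ℝ} (h : pfr u = 0) : qfr u ≠ 0 := by
  intro hq
  have := pfr_sq_add_qfr_sq u
  rw [h, hq] at this; norm_num at this

/-- **The framing field** `fr(u) = (0, p(u), q(u))`. [folklore] -/
def fr (u : ℝ) : E3 := !₂[0, pfr u, qfr u]

/-- The vertical vector `e_z`. [folklore] -/
def ez : E3 := !₂[0, 0, 1]

/-- The framing has no `x`-component. [folklore] -/
@[simp] theorem fr_apply_zero (u : ℝ) : fr u 0 = 0 := by simp [fr]
/-- The `y`-component of the framing is `p`. [folklore] -/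
@[simp] theorem fr_apply_one (u : ℝ) : fr u 1 = pfr u := by simp [fr]
/-- The `z`-component of the framing is `q`. [folklore] -/
@[simp] theorem fr_apply_two (u : ℝ) : fr u 2 = qfr u := by simp [fr]
/-- Coordinates of `e_z`. [folklore] -/
@[simp] theorem ez_apply_zero : ez 0 = 0 := by simp [ez]
/-- Coordinates of `e_z`. [folklore] -/
@[simp] theorem ez_apply_one : ez 1 = 0 := by simp [ez]
/-- Coordinates of `e_z`. [folklore] -/
@[simp] theorem ez_apply_two : ez 2 = 1 := by simp [ez]

/-- The framing field is continuous. [folklore] -/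
theorem continuous_fr : Continuous fr := by
  have h : Continuous fun u => (![0, pfr u, qfr u] : Fin 3 → ℝ) := by
    refine continuous_pi fun i => ?_
    fin_cases i
    · simpa using continuous_const
    · simpa using continuous_pfr
    · simpa using continuous_qfr
  exact (EuclideanSpace.equiv (Fin 3) ℝ).symm.continuous.comp h

/-- `fr = e_z` on `(-∞, -t₀]`. [folklore] -/
theorem fr_of_le {u : ℝ} (hu : u ≤ -t0) : fr u = ez :=
  euclidean_three_ext (by simp) (by simp [pfr_of_le hu]) (by simp [qfr_of_le hu])

/-- `fr = e_z` on `[t₀ + 1, ∞)`. [folklore] -/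
theorem fr_of_ge {u : ℝ} (hu : t0 + 1 ≤ u) : fr u = ez :=
  euclidean_three_ext (by simp) (by simp [pfr_of_ge hu]) (by simp [qfr_of_ge hu])

/-- Off `(-2, 2)` the framing is `e_z`. [folklore] -/
theorem fr_eq_ez {u : ℝ} (hu : 2 ≤ |u|) : fr u = ez := by
  rcases le_abs'.1 hu with h | h
  · exact fr_of_le (by linarith [t0_lt_one])
  · exact fr_of_ge (by linarith [t0_lt_one])

/-- The framing never vanishes. [folklore] -/
theorem fr_ne_zero (u : ℝ) : fr u ≠ 0 := fun h => by
  have h1 : pfr u = 0 := by simpa using congrArg (fun v : E3 => v 1) h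
  have h2 : qfr u = 0 := by simpa using congrArg (fun v : E3 => v 2) h
  exact qfr_ne_zero_of_pfr_eq_zero h1 h2

/-- **Non-tangency**: the framing is never a multiple of the velocity of a stage, even after the
anisotropic rescaling `(x', y', ε z')` of the velocity (`0 < ε`, `0 ≤ τ ≤ 1`). [folklore] -/
theorem fr_ne_smul {ε τ : ℝ} (hε : 0 < ε) (hτ : τ ∈ Icc (0 : ℝ) 1) (u c : ℝ) :
    fr u ≠ c • (!₂[dcurve τ u 0, dcurve τ u 1, ε * dcurve τ u 2] : E3) := by
  intro h
  have h0 : (0 : ℝ) = c * (1 + τ * (xd u - 1)) := by simpa using congrArg (fun v : E3 => v 0) h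
  have h1 : pfr u = c * (τ * dY u) := by simpa using congrArg (fun v : E3 => v 1) h
  have h2 : qfr u = c * (ε * (τ * (Y u * xd u))) := by simpa using congrArg (fun v : E3 => v 2) h
  rcases eq_or_ne c 0 with rfl | hc
  · exact qfr_ne_zero_of_pfr_eq_zero (by simpa using h1) (by simpa using h2)
  have ha : 1 + τ * (xd u - 1) = 0 := by
    rcases mul_eq_zero.1 h0.symm with h' | h'
    · exact absurd h' hc
    · exact h'
  have hτ0 : τ ≠ 0 := by rintro rfl; simp at ha
  have hτpos : 0 < τ := hτ.1.lt_of_ne' hτ0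
  have hxd : xd u ≤ 0 := by nlinarith [hτ.2]
  have hu : |u| ≤ t0 := xd_nonpos_iff.1 hxd
  have hu4 : |u| < 4 := abs_lt_four_of_abs_le_t0 hu
  have hmem : u ∈ Icc (-t0) t0 := abs_le.1 hu
  have hN := Nrm_pos hu4
  rw [pfr_of_mem hmem] at h1
  rw [qfr_of_mem hmem] at h2
  -- `-Y x' = N c τ Y'` and `Y' = N c ε τ Y x'`
  have e1 : -(Y u * xd u) = Nrm u * (c * (τ * dY u)) := by
    rw [← h1]; field_simp
  have e2 : dY u = Nrm u * (c * (ε * (τ * (Y u * xd u)))) := by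
    rw [← h2]; field_simp
  have e3 : Y u * xd u * (1 + (Nrm u * c * τ) ^ 2 * ε) = 0 := by
    have := e1
    rw [e2] at this
    nlinarith [this]
  have hYxd : Y u * xd u = 0 := by
    rcases mul_eq_zero.1 e3 with h' | h'
    · exact h'
    · nlinarith [sq_nonneg (Nrm u * c * τ)]
  have hxd0 : xd u = 0 := (mul_eq_zero.1 hYxd).resolve_left (Y_pos hu4).ne'
  have hdY : dY u = 0 := by rw [e2, hYxd]; ring
  have hut : |u| = t0 := xd_eq_zero_iff.1 hxd0
  have hu0 : u ≠ 0 := fun h0' => by rw [h0', abs_zero] at hut; exact t0_pos.ne hut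
  exact dY_ne_zero hu0 hu4 hdY

/-- Non-tangency for the rescaled family: `fr (t/ε)` is not a multiple of the velocity of
`K^ε_τ` at `t`. [folklore] -/
theorem fr_ne_smul_dscurve {ε τ : ℝ} (hε : 0 < ε) (hτ : τ ∈ Icc (0 : ℝ) 1) (t c : ℝ) :
    fr (t / ε) ≠ c • dscurve ε τ t :=
  fr_ne_smul hε hτ (t / ε) c

/-! ### The twisting loops of the model and their logarithms

With respect to the frame `(∂_y, ∂_z)`-type coordinates `(dα₀(K', ν), α₀(ν))`, `α₀ = dz - y dx`,
the twisting loop of the axis with the framing `fr` is `v₀ = p + i q`, and that of the stabilised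
arc `K₁` with the framing `fr` is `v₁ = x' p + i q` (`dα₀ = dx ∧ dy` kills the `z`-components, and
`α₀(fr) = q` since `fr` has no `x`-component).  We exhibit continuous logarithms: `v₀` stays in
the closed right half-plane, so its logarithm returns to its initial value, while the logarithm
of `v₁` increases by `2πi` across the window: **the stabilisation adds one full positive turn**. -/

/-- The model twisting loop of the axis framed by `fr`: `p + i q`. [folklore] -/
def v0 (u : ℝ) : ℂ := (pfr u : ℂ) + (qfr u : ℂ) * Complex.I

/-- The model twisting loop of the stabilised arc framed by `fr`: `x' p + i q`. [folklore] -/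
def v1 (u : ℝ) : ℂ := ((xd u * pfr u : ℝ) : ℂ) + (qfr u : ℂ) * Complex.I

/-- `Re v₀ = p`. [folklore] -/
@[simp] theorem v0_re (u : ℝ) : (v0 u).re = pfr u := by simp [v0]
/-- `Im v₀ = q`. [folklore] -/
@[simp] theorem v0_im (u : ℝ) : (v0 u).im = qfr u := by simp [v0]
/-- `Re v₁ = x' p`. [folklore] -/
@[simp] theorem v1_re (u : ℝ) : (v1 u).re = xd u * pfr u := by simp [v1]
/-- `Im v₁ = q`. [folklore] -/
@[simp] theorem v1_im (u : ℝ) : (v1 u).im = qfr u := by simp [v1]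

/-- `v₀` is continuous. [folklore] -/
theorem continuous_v0 : Continuous v0 :=
  (Complex.continuous_ofReal.comp continuous_pfr).add
    ((Complex.continuous_ofReal.comp continuous_qfr).mul continuous_const)

/-- `v₁` is continuous. [folklore] -/
theorem continuous_v1 : Continuous v1 :=
  (Complex.continuous_ofReal.comp (continuous_xd.mul continuous_pfr)).add
    ((Complex.continuous_ofReal.comp continuous_qfr).mul continuous_const)

/-- `e^{iπ/2} = i`. [folklore] -/
theorem exp_pi_div_two_mul_I : Complex.exp ((π / 2 : ℝ) * Complex.I) = Complex.I := by
  rw [show ((π / 2 : ℝ) : ℂ) * Complex.I = (π : ℂ) / 2 * Complex.I by push_cast; ring,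
    ← Complex.log_I, Complex.exp_log Complex.I_ne_zero]

/-- `v₀` stays in the slit plane (`p ≥ 0`, and `q ≠ 0` where `p = 0`). [folklore] -/
theorem v0_mem_slitPlane (u : ℝ) : v0 u ∈ Complex.slitPlane := by
  rw [Complex.mem_slitPlane_iff, v0_re, v0_im]
  rcases (pfr_nonneg u).lt_or_eq with h | h
  · exact Or.inl h
  · exact Or.inr (qfr_ne_zero_of_pfr_eq_zero h.symm)

/-- `v₀ ≠ 0`. [folklore] -/
theorem v0_ne_zero (u : ℝ) : v0 u ≠ 0 := Complex.slitPlane_ne_zero (v0_mem_slitPlane u)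

/-- `v₀ = i` on `(-∞, -t₀]`. [folklore] -/
theorem v0_of_le {u : ℝ} (hu : u ≤ -t0) : v0 u = Complex.I :=
  Complex.ext (by simp [pfr_of_le hu]) (by simp [qfr_of_le hu])

/-- `v₀ = i` on `[t₀ + 1, ∞)`. [folklore] -/
theorem v0_of_ge {u : ℝ} (hu : t0 + 1 ≤ u) : v0 u = Complex.I :=
  Complex.ext (by simp [pfr_of_ge hu]) (by simp [qfr_of_ge hu])

/-- `v₁ = i` on `(-∞, -t₀]`. [folklore] -/
theorem v1_of_le {u : ℝ} (hu : u ≤ -t0) : v1 u = Complex.I :=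
  Complex.ext (by simp [pfr_of_le hu]) (by simp [qfr_of_le hu])

/-- `v₁ = i` on `[t₀ + 1, ∞)`. [folklore] -/
theorem v1_of_ge {u : ℝ} (hu : t0 + 1 ≤ u) : v1 u = Complex.I :=
  Complex.ext (by simp [pfr_of_ge hu]) (by simp [qfr_of_ge hu])

/-- `|v₀| = 1`. [folklore] -/
theorem norm_v0 (u : ℝ) : ‖v0 u‖ = 1 := by
  rw [Complex.norm_eq_sqrt_sq_add_sq, v0_re, v0_im, pfr_sq_add_qfr_sq, Real.sqrt_one]

/-- **The logarithm of the axis loop**: the principal branch, continuous since `p ≥ 0`. [folklore] -/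
def l0 (u : ℝ) : ℂ := Complex.log (v0 u)

/-- `l₀` is continuous (principal logarithm on the slit plane). [folklore] -/
theorem continuous_l0 : Continuous l0 :=
  continuous_iff_continuousAt.2 fun u => (continuous_v0.continuousAt).clog (v0_mem_slitPlane u)

/-- `l₀` is a logarithm of `v₀`. [folklore] -/
theorem exp_l0 (u : ℝ) : Complex.exp (l0 u) = v0 u := Complex.exp_log (v0_ne_zero u)

/-- `l₀ = iπ/2` on `(-∞, -t₀]`. [folklore] -/
theorem l0_of_le {u : ℝ} (hu : u ≤ -t0) : l0 u = (π / 2 : ℝ) * Complex.I := by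
  rw [l0, v0_of_le hu, Complex.log_I]; push_cast; ring

/-- `l₀ = iπ/2` on `[t₀ + 1, ∞)`. [folklore] -/
theorem l0_of_ge {u : ℝ} (hu : t0 + 1 ≤ u) : l0 u = (π / 2 : ℝ) * Complex.I := by
  rw [l0, v0_of_ge hu, Complex.log_I]; push_cast; ring

/-- Off `(-2, 2)` the logarithm of the axis loop is `iπ/2`. [folklore] -/
theorem l0_eq {u : ℝ} (hu : 2 ≤ |u|) : l0 u = (π / 2 : ℝ) * Complex.I := by
  rcases le_abs'.1 hu with h | h
  · exact l0_of_le (by linarith [t0_lt_one])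
  · exact l0_of_ge (by linarith [t0_lt_one])

/-- `Re l₀ = 0` (`v₀` is a unit vector). [folklore] -/
theorem l0_re (u : ℝ) : (l0 u).re = 0 := by
  rw [l0, Complex.log_re, norm_v0, Real.log_one]

/-- **The axis loop does not wind**: its logarithm has the same value at `±2`. [folklore] -/
theorem l0_two_sub : l0 2 - l0 (-2) = 0 := by
  rw [l0_eq (by norm_num), l0_eq (by norm_num), sub_self]

/-! The logarithm of `v₁`. -/

/-- On `[-t₀, t₀]`, `-v₁` lies in the slit plane (`x' ≤ 0`, `p ≥ 0`; at `±t₀`, `q = ±1`). [folklore] -/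
theorem neg_v1_mem_slitPlane {w : ℝ} (hw : w ∈ Icc (-t0) t0) : -v1 w ∈ Complex.slitPlane := by
  have hw4 : |w| < 4 := abs_lt_four_of_abs_le_t0 (abs_le.2 hw)
  have hN := Nrm_pos hw4
  rw [Complex.mem_slitPlane_iff, Complex.neg_re, Complex.neg_im, v1_re, v1_im, pfr_of_mem hw,
    qfr_of_mem hw]
  rcases eq_or_ne (xd w) 0 with h | h
  · right
    have hwt : |w| = t0 := xd_eq_zero_iff.1 h
    have hw0 : w ≠ 0 := fun h0 => by rw [h0, abs_zero] at hwt; exact t0_pos.ne hwt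
    have := dY_ne_zero hw0 hw4
    exact neg_ne_zero.2 (div_ne_zero this hN.ne')
  · left
    have hY := Y_pos hw4
    have : 0 < xd w ^ 2 := by positivity
    rw [show -(xd w * (-(Y w * xd w) / Nrm w)) = Y w * xd w ^ 2 / Nrm w by ring]
    positivity

/-- On `[t₀, t₀ + 1]`, `v₁` lies in the slit plane (`x' ≥ 0`, `sin ≥ 0`; `cos ≠ 0` where the real part vanishes). [folklore] -/
theorem v1_mem_slitPlane {w : ℝ} (hw : w ∈ Icc t0 (t0 + 1)) : v1 w ∈ Complex.slitPlane := by
  rw [Complex.mem_slitPlane_iff, v1_re, v1_im, pfr_of_mem_ret hw, qfr_of_mem_ret hw]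
  have hxd : 0 ≤ xd w := by
    rcases hw.1.eq_or_lt with h | h
    · rw [← h, xd_t0]
    · exact (xd_pos_of_t0_lt h).le
  have hθ0 : 0 ≤ π * (w - t0) := by nlinarith [Real.pi_pos, hw.1]
  have hθπ : π * (w - t0) ≤ π := by nlinarith [Real.pi_pos, hw.2]
  have hsin : 0 ≤ Real.sin (π * (w - t0)) := Real.sin_nonneg_of_nonneg_of_le_pi hθ0 hθπ
  by_cases hc : Real.cos (π * (w - t0)) = 0
  · left
    -- `cos θ = 0` forces `θ = π/2`, where `sin θ = 1`, and `w > t₀` gives `x' > 0`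
    have hs1 : Real.sin (π * (w - t0)) ^ 2 = 1 := by
      have := Real.sin_sq_add_cos_sq (π * (w - t0)); rw [hc] at this; linarith
    have hs : Real.sin (π * (w - t0)) = 1 := by nlinarith
    have hwt : w ≠ t0 := by
      rintro rfl; simp at hc
    rw [hs, mul_one]
    exact xd_pos_of_t0_lt (hw.1.lt_of_ne' hwt)
  · right; simpa using hc

/-- The middle branch of the logarithm of `v₁`: `log (-v₁) + iπ` (clamped argument). [folklore] -/
def l1Mid (u : ℝ) : ℂ := Complex.log (-v1 (clampMid u)) + π * Complex.I

/-- The returning branch of the logarithm of `v₁`: `log v₁ + 2πi` (clamped argument). [folklore] -/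
def l1Ret (u : ℝ) : ℂ := Complex.log (v1 (clampRet u)) + 2 * π * Complex.I

/-- `l1Mid` is continuous. [folklore] -/
theorem continuous_l1Mid : Continuous l1Mid := by
  refine Continuous.add ?_ continuous_const
  refine continuous_iff_continuousAt.2 fun u => ?_
  exact ((continuous_v1.comp continuous_clampMid).neg.continuousAt).clog
    (neg_v1_mem_slitPlane (abs_le.1 (abs_clampMid_le u)))

/-- `l1Ret` is continuous. [folklore] -/
theorem continuous_l1Ret : Continuous l1Ret := by
  refine Continuous.add ?_ continuous_const
  refine continuous_iff_continuousAt.2 fun u => ?_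
  exact ((continuous_v1.comp continuous_clampRet).continuousAt).clog (v1_mem_slitPlane (clampRet_mem u))

/-- **The logarithm of the loop of the stabilised arc.** [folklore] -/
def l1 (u : ℝ) : ℂ :=
  if u ≤ -t0 then (π / 2 : ℝ) * Complex.I
  else if u ≤ t0 then l1Mid u
  else if u ≤ t0 + 1 then l1Ret u
  else (5 * π / 2 : ℝ) * Complex.I

/-- `v₁(-t₀) = i`. [folklore] -/
theorem v1_neg_t0 : v1 (-t0) = Complex.I := v1_of_le le_rfl

/-- `v₁(t₀) = -i`. [folklore] -/
theorem v1_t0 : v1 t0 = -Complex.I :=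
  Complex.ext (by simp [xd_t0]) (by simp [qfr_of_mem_ret ⟨le_rfl, by linarith⟩])

/-- `v₁(t₀ + 1) = i`. [folklore] -/
theorem v1_t0_add_one : v1 (t0 + 1) = Complex.I := v1_of_ge le_rfl

/-- `l1Mid (-t₀) = iπ/2`. [folklore] -/
theorem l1Mid_neg_t0 : l1Mid (-t0) = (π / 2 : ℝ) * Complex.I := by
  rw [l1Mid, clampMid_of_mem ⟨le_rfl, by linarith [t0_pos]⟩, v1_neg_t0, Complex.log_neg_I]
  push_cast; ring

/-- `l1Mid t₀ = 3iπ/2`. [folklore] -/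
theorem l1Mid_t0 : l1Mid t0 = (3 * π / 2 : ℝ) * Complex.I := by
  rw [l1Mid, clampMid_of_mem ⟨by linarith [t0_pos], le_rfl⟩, v1_t0, neg_neg, Complex.log_I]
  push_cast; ring

/-- `l1Ret t₀ = 3iπ/2`. [folklore] -/
theorem l1Ret_t0 : l1Ret t0 = (3 * π / 2 : ℝ) * Complex.I := by
  rw [l1Ret, clampRet_of_mem ⟨le_rfl, by linarith⟩, v1_t0, Complex.log_neg_I]
  push_cast; ring

/-- `l1Ret (t₀ + 1) = 5iπ/2`. [folklore] -/
theorem l1Ret_t0_add_one : l1Ret (t0 + 1) = (5 * π / 2 : ℝ) * Complex.I := by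
  rw [l1Ret, clampRet_of_mem ⟨by linarith, le_rfl⟩, v1_t0_add_one, Complex.log_I]
  push_cast; ring

/-- **`l₁` is continuous** (the branches match at `-t₀`, `t₀`, `t₀ + 1`). [folklore] -/
theorem continuous_l1 : Continuous l1 := by
  refine continuous_if_le continuous_id continuous_const continuousOn_const ?_ ?_
  · refine Continuous.continuousOn ?_
    refine continuous_if_le continuous_id continuous_const continuous_l1Mid.continuousOn ?_ ?_
    · exact (continuous_if_le continuous_id continuous_const continuous_l1Ret.continuousOn
        continuousOn_const (fun u hu => by rw [show u = t0 + 1 from hu, l1Ret_t0_add_one])).continuousOn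
    · intro u hu; rw [show u = t0 from hu, l1Mid_t0, if_pos (by linarith), l1Ret_t0]
  · intro u hu
    rw [show u = -t0 from hu, if_pos (by linarith [t0_pos]), l1Mid_neg_t0]

/-- `l₁` is a logarithm of `v₁`. [folklore] -/
theorem exp_l1 (u : ℝ) : Complex.exp (l1 u) = v1 u := by
  rcases le_or_gt u (-t0) with h1 | h1
  · rw [l1, if_pos h1, v1_of_le h1, exp_pi_div_two_mul_I]
  rcases le_or_gt u t0 with h2 | h2
  · have hmem : u ∈ Icc (-t0) t0 := ⟨h1.le, h2⟩
    rw [l1, if_neg (not_le.2 h1), if_pos h2, l1Mid, clampMid_of_mem hmem, Complex.exp_add,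
      Complex.exp_log (Complex.slitPlane_ne_zero (neg_v1_mem_slitPlane hmem)), Complex.exp_pi_mul_I]
    ring
  rcases le_or_gt u (t0 + 1) with h3 | h3
  · have hmem : u ∈ Icc t0 (t0 + 1) := ⟨h2.le, h3⟩
    rw [l1, if_neg (not_le.2 h1), if_neg (not_le.2 h2), if_pos h3, l1Ret, clampRet_of_mem hmem,
      Complex.exp_add, Complex.exp_log (Complex.slitPlane_ne_zero (v1_mem_slitPlane hmem)),
      Complex.exp_two_pi_mul_I, mul_one]
  · rw [l1, if_neg (not_le.2 h1), if_neg (not_le.2 h2), if_neg (not_le.2 h3), v1_of_ge h3.le]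
    rw [show ((5 * π / 2 : ℝ) : ℂ) * Complex.I = (π / 2 : ℝ) * Complex.I + 2 * π * Complex.I by
      push_cast; ring, Complex.exp_add, Complex.exp_two_pi_mul_I, mul_one, exp_pi_div_two_mul_I]

/-- `l₁ = iπ/2` on `(-∞, -t₀]`. [folklore] -/
theorem l1_of_le {u : ℝ} (hu : u ≤ -t0) : l1 u = (π / 2 : ℝ) * Complex.I := by rw [l1, if_pos hu]

/-- `l₁ = 5iπ/2` on `(t₀ + 1, ∞)`. [folklore] -/
theorem l1_of_gt {u : ℝ} (hu : t0 + 1 < u) : l1 u = (5 * π / 2 : ℝ) * Complex.I := by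
  rw [l1, if_neg (by linarith [t0_pos]), if_neg (by linarith), if_neg (not_le.2 hu)]

/-- **The stabilised arc winds once**: the logarithm of its loop increases by `2πi` from `-2`
to `2`. [folklore] -/
theorem l1_two_sub : l1 2 - l1 (-2) = 2 * π * Complex.I := by
  rw [l1_of_gt (by linarith [t0_lt_one]), l1_of_le (by linarith [t0_lt_one])]
  push_cast; ring

/-- Off `(-2, 2)`, `l₁` is locally constant: `iπ/2` on the left, `5iπ/2` on the right. [folklore] -/
theorem l1_eq_of_le {u : ℝ} (hu : u ≤ -2) : l1 u = l1 (-2) := by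
  rw [l1_of_le (by linarith [t0_lt_one]), l1_of_le (by linarith [t0_lt_one])]

/-- `l₁` is constant on `[2, ∞)`. [folklore] -/
theorem l1_eq_of_ge {u : ℝ} (hu : 2 ≤ u) : l1 u = l1 2 := by
  rw [l1_of_gt (by linarith [t0_lt_one]), l1_of_gt (by linarith [t0_lt_one])]

/-! ### Phase 0: rotating the constant framing `e_z` into `fr` along the fixed axis

Along the `x`-axis every non-zero vector of the `(y, z)`-plane is a framing, and
`fr_s = exp((1 - s) iπ/2 + s l₀)` (read in the `(y, z)`-plane) is a homotopy of such from `e_z`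
to `fr`, constant (`= e_z`) off `(-2, 2)`. -/

/-- The phase-0 homotopy of framings of the axis, as a complex number `p_s + i q_s`. [folklore] -/
def w0 (s u : ℝ) : ℂ := Complex.exp ((1 - s : ℝ) * ((π / 2 : ℝ) * Complex.I) + (s : ℝ) * l0 u)

/-- **The phase-0 homotopy of framings** `frh s u = (0, Re w₀, Im w₀)`. [folklore] -/
def frh (s u : ℝ) : E3 := !₂[0, (w0 s u).re, (w0 s u).im]

/-- `w₀` is jointly continuous. [folklore] -/
theorem continuous_w0 : Continuous fun p : ℝ × ℝ => w0 p.1 p.2 := by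
  unfold w0
  refine Complex.continuous_exp.comp ?_
  refine Continuous.add ?_ ?_
  · exact (Complex.continuous_ofReal.comp (continuous_const.sub continuous_fst)).mul continuous_const
  · exact (Complex.continuous_ofReal.comp continuous_fst).mul (continuous_l0.comp continuous_snd)

/-- The phase-0 homotopy is jointly continuous. [folklore] -/
theorem continuous_frh : Continuous fun p : ℝ × ℝ => frh p.1 p.2 := by
  have h : Continuous fun p : ℝ × ℝ => (![0, (w0 p.1 p.2).re, (w0 p.1 p.2).im] : Fin 3 → ℝ) := by
    refine continuous_pi fun i => ?_
    fin_cases i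
    · simpa using continuous_const
    · have hre : Continuous fun p : ℝ × ℝ => (w0 p.1 p.2).re := Complex.continuous_re.comp continuous_w0
      simpa using hre
    · have him : Continuous fun p : ℝ × ℝ => (w0 p.1 p.2).im := Complex.continuous_im.comp continuous_w0
      simpa using him
  exact (EuclideanSpace.equiv (Fin 3) ℝ).symm.continuous.comp h

/-- The phase-0 homotopy has no `x`-component. [folklore] -/
@[simp] theorem frh_apply_zero (s u : ℝ) : frh s u 0 = 0 := by simp [frh]

/-- `w₀(0, u) = i`. [folklore] -/
theorem w0_zero_left (u : ℝ) : w0 0 u = Complex.I := by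
  rw [w0]; push_cast
  rw [show ((1 : ℂ) - 0) * (π / 2 * Complex.I) + 0 * l0 u = (π / 2 : ℝ) * Complex.I by push_cast; ring,
    exp_pi_div_two_mul_I]

/-- `w₀(1, u) = v₀(u)`. [folklore] -/
theorem w0_one_left (u : ℝ) : w0 1 u = v0 u := by
  rw [w0]; push_cast
  rw [show ((1 : ℂ) - 1) * (π / 2 * Complex.I) + 1 * l0 u = l0 u by ring, exp_l0]

/-- `w₀(s, u) = i` for `2 ≤ |u|`. [folklore] -/
theorem w0_of_two_le (s : ℝ) {u : ℝ} (hu : 2 ≤ |u|) : w0 s u = Complex.I := by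
  rw [w0, l0_eq hu]
  rw [show ((1 - s : ℝ) : ℂ) * ((π / 2 : ℝ) * Complex.I) + (s : ℝ) * ((π / 2 : ℝ) * Complex.I) =
    (π / 2 : ℝ) * Complex.I by push_cast; ring, exp_pi_div_two_mul_I]

/-- `w₀ ≠ 0`. [folklore] -/
theorem w0_ne_zero (s u : ℝ) : w0 s u ≠ 0 := Complex.exp_ne_zero _

/-- The homotopy starts at `e_z`. [folklore] -/
theorem frh_zero_left (u : ℝ) : frh 0 u = ez :=
  euclidean_three_ext (by simp) (by simp [frh, w0_zero_left]) (by simp [frh, w0_zero_left])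

/-- The homotopy ends at `fr`. [folklore] -/
theorem frh_one_left (u : ℝ) : frh 1 u = fr u :=
  euclidean_three_ext (by simp) (by simp [frh, w0_one_left]) (by simp [frh, w0_one_left])

/-- The homotopy is constant `e_z` off `(-2, 2)`. [folklore] -/
theorem frh_of_two_le (s : ℝ) {u : ℝ} (hu : 2 ≤ |u|) : frh s u = ez :=
  euclidean_three_ext (by simp) (by simp [frh, w0_of_two_le s hu]) (by simp [frh, w0_of_two_le s hu])

/-- The homotopy never vanishes. [folklore] -/
theorem frh_ne_zero (s u : ℝ) : frh s u ≠ 0 := fun h => by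
  have h1 : (w0 s u).re = 0 := by simpa [frh] using congrArg (fun v : E3 => v 1) h
  have h2 : (w0 s u).im = 0 := by simpa [frh] using congrArg (fun v : E3 => v 2) h
  exact w0_ne_zero s u (Complex.ext h1 h2)

/-- Along the axis (velocity `(c, 0, 0)`-direction) the homotopy is a framing: it is never a
multiple of a vector with vanishing `(y, z)`-components. [folklore] -/
theorem frh_ne_smul (s u c : ℝ) {w : E3} (hw1 : w 1 = 0) (hw2 : w 2 = 0) : frh s u ≠ c • w := by
  intro h
  apply frh_ne_zero s u
  refine euclidean_three_ext (by simp) ?_ ?_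
  · have := congrArg (fun v : E3 => v 1) h
    simp only [PiLp.smul_apply, smul_eq_mul, hw1, mul_zero] at this
    simpa using this
  · have := congrArg (fun v : E3 => v 2) h
    simp only [PiLp.smul_apply, smul_eq_mul, hw2, mul_zero] at this
    simpa using this

end Literature.Geometry.Symplectic.LegendrianModel

end
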